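import Summits.AtomisticToContinuum.FouriersLaw.Theorems.LocalOhmBVLocalOhmStubSoftExtractionWeak

/-!
# Stub `stub_softExtractionWeakSqrt` (T♯1) of the birth line of crux `LocalOhmBV.LocalOhm`

Crux item stmt-AtomisticToContinuum-12009 (`Summit.AtomisticToContinuum.FouriersLaw.Theses.LocalOhmBV.LocalOhm`),
line `registered` (birth; reshaped by lead c5: the interior estimate S1 is taken at its CLT scale
S1♯, `A(ℓ) = A √(ℓ+1)` with ONE constant `A`, and the weak soft extraction S2c' accordingly becomes
T♯1). This file proves the WEAK SOFT EXTRACTION IN THE `√n` CLASS: verbatim the landed S2c'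
`LocalOhmBirth.stub_softExtractionWeak` (`…StubSoftExtractionWeak`) except that

* the interior a-priori estimate (A) `∀ ℓ, ∃ b A, … ≤ A ‖ψ‖₂ (…)` is replaced by its CLT-scale form
  (A♯) `∃ A, ∀ ℓ, ∃ b, … ≤ A √(ℓ+1) ‖ψ‖₂ (…)`, and
* the regularity clause (2) of the extracted functional `Λ` is SHARPENED from "for every `n` some
  constant `A(n)`" to the `√n` class: ONE constant `A'` with
  `|Λ(g ∘ boxRestrictAt a n)| ≤ A' √(n+1) ‖g ∘ boxRestrictAt a n‖_{L²(μ∞)}` for all `n`, `a`, `g`.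

No new mathematics: the landed proof is fed, at window radius `n`, with the constant `A √(n+1)`
(hypothesis (A♯) at `ℓ = n` is literally the interior estimate with that constant), so the eventual
level bound (`…WeakAux1.eventually_level_bound'`) holds with `2|A √(n+1)| = 2|A| √(n+1)` and the
`ε`'s are removed in the generalised limit (`abs_hyperfilter_limUnder_le_mul_sqrt_succ` below, from
the landed `abs_hyperfilter_limUnder_le_mul_sqrt`); clauses (1) linearity, (3) invariance, (4) unit
current are assembled exactly as in the landed file.
-/

set_option autoImplicit false

noncomputable section

namespace Summit.AtomisticToContinuum.FouriersLaw.Theorems.LocalOhmBirth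

open MeasureTheory Filter Topology
open scoped BigOperators
open Literature.MathematicalPhysics.KineticTheory.HeatConduction
open Summit.AtomisticToContinuum.FouriersLaw.Theorems.WindowLimit (embed)
open Summit.AtomisticToContinuum.FouriersLaw.Theorems.LocalOhmBirth.SoftExtraction

/-- **Regularity in the generalised limit, `√n` class**: if for every `ε > 0` the real sequence
`u` is eventually bounded in absolute value by `2|A √(n+1)| √(S + ε) + ε` — the eventual weak level
bound `…WeakAux1.eventually_level_bound'` fed, at window radius `n`, with the CLT-scale constant
`A √(n+1)` of the interior estimate (A♯) — then its generalised limit along `hyperfilter ℕ` is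
bounded by `2|A| √(n+1) √S` (`abs_hyperfilter_limUnder_le_mul_sqrt` and `|A √(n+1)| = |A| √(n+1)`).
This is how the level bound yields the `√n`-regularity clause (2♯) with the single constant `2|A|`.
[folklore] -/
theorem abs_hyperfilter_limUnder_le_mul_sqrt_succ :
    ∀ {u : ℕ → ℝ} {A S : ℝ} (n : ℕ), (∀ ε : ℝ, 0 < ε → ∀ᶠ k in atTop,
      |u k| ≤ 2 * |A * Real.sqrt ((n : ℝ) + 1)| * Real.sqrt (S + ε) + ε) →
      |limUnder (hyperfilter ℕ : Filter ℕ) u| ≤ 2 * |A| * Real.sqrt ((n : ℝ) + 1) * Real.sqrt S :=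
  fun n h => by
    rw [← abs_of_nonneg (Real.sqrt_nonneg ((n : ℝ) + 1)), mul_assoc 2, ← abs_mul]
    exact abs_hyperfilter_limUnder_le_mul_sqrt h

/-- **T♯1 `stub_softExtractionWeakSqrt`** (the weak soft extraction IN THE `√n` CLASS of the birth
line of `LocalOhmBV.LocalOhm`). In the frame of `LocalOhm`: the interior estimate at the CLT scale
(A♯) (one constant `A`, window constant `A √(ℓ+1)`), the conclusions of S2a (for the frame's family)
and of S2b (for a given shift-invariant Gibbs state `μinf`, window–energy covariance bound in the
per-observable form), and a violating sequence give the bad functional `Λ` relative to `μinf`: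
(1) linear, (2♯) `√n`-regular with ONE constant,
`|Λ(g ∘ boxRestrictAt a n)| ≤ A' √(n+1) ‖g ∘ boxRestrictAt a n‖_{L²(μinf)}`, (3) `liouvilleZ`-invariant,
(4) unit current on every bond. Construction as in `stub_softExtractionWeak`:
`g_k = d_k/(N_k - 1) ≠ 0`, `Λ_k(F) = (ρ_k(F ∘ embed N_k x_k) - θ_k(x_k) Cov_{Gibbs_{N_k}}(F ∘ embed N_k x_k, H_{N_k})/T²)/g_k`,
`Λ = limUnder (hyperfilter ℕ) Λ_k`; the level bound at radius `n` uses (A♯) at `ℓ = n` with the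
constant `A √(n+1)`, whence `A' = 2|A|`. [folklore] -/
theorem stub_softExtractionWeakSqrt :
    ∀ ω₂ lam β γ : ℝ, 0 < ω₂ → 0 < lam → 0 < β → 0 < γ →
    (∀ (N : ℕ) (T_L T_R : ℝ), 0 < T_L → 0 < T_R → ∀ μ ν : Measure (PhaseSpace N),
      (pinnedChain ω₂ lam β γ).IsSteadyState N T_L T_R μ →
      (pinnedChain ω₂ lam β γ).IsSteadyState N T_L T_R ν → μ = ν) →
    ∀ μ : (N : ℕ) → ℝ → ℝ → Measure (PhaseSpace N),
    (∀ (N : ℕ) (T_L T_R : ℝ), 0 < T_L → 0 < T_R →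
      (pinnedChain ω₂ lam β γ).IsSteadyState N T_L T_R (μ N T_L T_R)) →
    ∀ T : ℝ, 0 < T →
    -- (A♯) the interior a-priori estimate at the CLT scale (S1♯), verbatim
    (∃ A : ℝ, ∀ ℓ : ℕ, ∃ b : ℕ, ∀ (N : ℕ) (d : ℝ) (θ : Fin N → ℝ),
      Tendsto (fun δ : ℝ => (pinnedChain ω₂ lam β γ).totalCurrent (μ N (T + δ / 2) (T - δ / 2)) / δ)
        (𝓝[≠] 0) (𝓝 d) →
      (∀ i : Fin N, Tendsto (fun δ : ℝ => ((∫ x, (x.2 i) ^ 2 ∂(μ N (T + δ / 2) (T - δ / 2))) -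
        ∫ x, (x.2 i) ^ 2 ∂(μ N T T)) / δ) (𝓝[≠] 0) (𝓝 (θ i))) →
      ∀ x : ℕ, b + ℓ ≤ x → x + ℓ + b + 2 ≤ N →
      ∀ ψ : PhaseSpace N → ℝ, Continuous ψ →
        (∀ z z' : PhaseSpace N, (∀ i : Fin N, x ≤ i.val + ℓ → i.val ≤ x + ℓ + 1 →
          z.1 i = z'.1 i ∧ z.2 i = z'.2 i) → ψ z = ψ z') →
        (∃ (C₀ : ℝ) (m : ℕ), ∀ z, |ψ z| ≤ C₀ * (1 + ‖z‖) ^ m) →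
        ∀ ρ : ℝ, Tendsto (fun δ : ℝ => ((∫ z, ψ z ∂(μ N (T + δ / 2) (T - δ / 2))) -
          ∫ z, ψ z ∂(μ N T T)) / δ) (𝓝[≠] 0) (𝓝 ρ) →
        |ρ - (∑ i : Fin N, if i.val = x then θ i else 0) *
            (((∫ z, ψ z * (pinnedChain ω₂ lam β γ).hamiltonian N z ∂(μ N T T)) -
              (∫ z, ψ z ∂(μ N T T)) * (∫ z, (pinnedChain ω₂ lam β γ).hamiltonian N z ∂(μ N T T))) /
              T ^ 2)| ≤
          A * Real.sqrt ((ℓ : ℝ) + 1) * Real.sqrt (∫ z, (ψ z) ^ 2 ∂(μ N T T)) *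
            (|d| / ((N : ℝ) - 1) + ∑ i : Fin N, ∑ j : Fin N,
              (if j.val = i.val + 1 ∧ x ≤ i.val + ℓ ∧ i.val ≤ x + ℓ then |θ j - θ i| else 0))) →
    -- (S2a) the finite-`N` package, verbatim the conclusion of `stub_finiteResponsePackage`
    (∀ N : ℕ, 3 ≤ N →
      μ N T T = (pinnedChain ω₂ lam β γ).gibbsMeasure N T ∧
      (∀ ψ : PhaseSpace N → ℝ, Continuous ψ →
        (∃ (C₀ : ℝ) (m : ℕ), ∀ z, |ψ z| ≤ C₀ * (1 + ‖z‖) ^ m) →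
        ∃ ρ : ℝ, Tendsto (fun δ : ℝ => ((∫ z, ψ z ∂(μ N (T + δ / 2) (T - δ / 2))) -
          ∫ z, ψ z ∂(μ N T T)) / δ) (𝓝[≠] 0) (𝓝 ρ)) ∧
      (∀ (T_L T_R : ℝ), 0 < T_L → 0 < T_R → ∀ (a : ℤ) (n c : ℕ), 1 ≤ a + c → a + c + n + 2 ≤ N →
        ∀ G : (Fin (n + 1) → ℝ × ℝ) → ℝ, ContDiff ℝ 1 G →
        (∃ (C₀ : ℝ) (m : ℕ), ∀ y, |G y| ≤ C₀ * (1 + ‖y‖) ^ m ∧ ‖fderiv ℝ G y‖ ≤ C₀ * (1 + ‖y‖) ^ m) →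
        Integrable (fun z => liouvilleZ (pinnedChain ω₂ lam β γ) (G ∘ boxRestrictAt a n) (embed N c z))
            (μ N T_L T_R) ∧
          ∫ z, liouvilleZ (pinnedChain ω₂ lam β γ) (G ∘ boxRestrictAt a n) (embed N c z) ∂(μ N T_L T_R) =
            0) ∧
      (∀ (T_L T_R : ℝ), 0 < T_L → 0 < T_R → ∀ i k : Fin N, i.val + 2 ≤ N → k.val + 2 ≤ N →
        ∫ z, (pinnedChain ω₂ lam β γ).bondCurrent N i z ∂(μ N T_L T_R) =
          ∫ z, (pinnedChain ω₂ lam β γ).bondCurrent N k z ∂(μ N T_L T_R))) →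
    -- (S2b) the equilibrium package for a given shift-invariant Gibbs state `μinf`
    ∀ μinf : Measure ChainConfig, (pinnedChain ω₂ lam β γ).IsChainGibbsMeasure T μinf →
    IsShiftInvariant μinf →
    (∀ (a : ℤ) (n : ℕ) (g : (Fin (n + 1) → ℝ × ℝ) → ℝ), Continuous g →
      (∃ (C₀ : ℝ) (m : ℕ), ∀ y, |g y| ≤ C₀ * (1 + ‖y‖) ^ m) →
      Integrable (fun σ => g (boxRestrictAt a n σ)) μinf) →
    (∀ (N : ℕ) (ψ : PhaseSpace N → ℝ), Continuous ψ →
      (∃ (C₀ : ℝ) (m : ℕ), ∀ z, |ψ z| ≤ C₀ * (1 + ‖z‖) ^ m) →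
      Integrable ψ ((pinnedChain ω₂ lam β γ).gibbsMeasure N T) ∧
        Integrable (fun z => ψ z * (pinnedChain ω₂ lam β γ).hamiltonian N z)
          ((pinnedChain ω₂ lam β γ).gibbsMeasure N T)) →
    (∀ (N : ℕ) (i : Fin N),
      (∫ z, (pinnedChain ω₂ lam β γ).bondCurrent N i z * (pinnedChain ω₂ lam β γ).hamiltonian N z
          ∂((pinnedChain ω₂ lam β γ).gibbsMeasure N T)) -
        (∫ z, (pinnedChain ω₂ lam β γ).bondCurrent N i z ∂((pinnedChain ω₂ lam β γ).gibbsMeasure N T)) *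
          (∫ z, (pinnedChain ω₂ lam β γ).hamiltonian N z ∂((pinnedChain ω₂ lam β γ).gibbsMeasure N T)) =
        0) →
    (∀ (N : ℕ) (a : ℤ) (n c : ℕ), 1 ≤ a + c → a + c + n + 2 ≤ N →
      ∀ G : (Fin (n + 1) → ℝ × ℝ) → ℝ, ContDiff ℝ 1 G →
      (∃ (C₀ : ℝ) (m : ℕ), ∀ y, |G y| ≤ C₀ * (1 + ‖y‖) ^ m ∧ ‖fderiv ℝ G y‖ ≤ C₀ * (1 + ‖y‖) ^ m) →
      (∫ z, liouvilleZ (pinnedChain ω₂ lam β γ) (G ∘ boxRestrictAt a n) (embed N c z) *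
          (pinnedChain ω₂ lam β γ).hamiltonian N z ∂((pinnedChain ω₂ lam β γ).gibbsMeasure N T)) -
        (∫ z, liouvilleZ (pinnedChain ω₂ lam β γ) (G ∘ boxRestrictAt a n) (embed N c z)
            ∂((pinnedChain ω₂ lam β γ).gibbsMeasure N T)) *
          (∫ z, (pinnedChain ω₂ lam β γ).hamiltonian N z ∂((pinnedChain ω₂ lam β γ).gibbsMeasure N T)) =
        0) →
    (∀ (n : ℕ) (g : (Fin (n + 1) → ℝ × ℝ) → ℝ), Continuous g →
      (∃ (C₀ : ℝ) (m : ℕ), ∀ y, |g y| ≤ C₀ * (1 + ‖y‖) ^ m) →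
      ∃ B : ℝ, ∀ (N c : ℕ) (a : ℤ), 0 ≤ a + c → a + c + n < N →
      |(∫ z, g (boxRestrictAt a n (embed N c z)) * (pinnedChain ω₂ lam β γ).hamiltonian N z
            ∂((pinnedChain ω₂ lam β γ).gibbsMeasure N T)) -
          (∫ z, g (boxRestrictAt a n (embed N c z)) ∂((pinnedChain ω₂ lam β γ).gibbsMeasure N T)) *
            (∫ z, (pinnedChain ω₂ lam β γ).hamiltonian N z ∂((pinnedChain ω₂ lam β γ).gibbsMeasure N T))| ≤
        B) →
    (∀ (n : ℕ) (g : (Fin (n + 1) → ℝ × ℝ) → ℝ), Continuous g →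
      (∃ (C₀ : ℝ) (m : ℕ), ∀ y, |g y| ≤ C₀ * (1 + ‖y‖) ^ m) →
      ∀ ε : ℝ, 0 < ε → ∃ L N₀ : ℕ, ∀ (N c : ℕ) (a : ℤ), N₀ ≤ N → (L : ℤ) ≤ a + c →
        a + c + n + L < N →
        |(∫ z, g (boxRestrictAt a n (embed N c z)) ∂((pinnedChain ω₂ lam β γ).gibbsMeasure N T)) -
            ∫ σ, g (boxRestrictAt a n σ) ∂μinf| ≤ ε) →
    -- the violating sequence, verbatim
    ∀ (Nk : ℕ → ℕ) (dk : ℕ → ℝ) (θk : (k : ℕ) → Fin (Nk k) → ℝ) (xk : ℕ → ℕ),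
    (∀ k : ℕ, Tendsto (fun δ : ℝ =>
        (pinnedChain ω₂ lam β γ).totalCurrent (μ (Nk k) (T + δ / 2) (T - δ / 2)) / δ) (𝓝[≠] 0) (𝓝 (dk k))) →
    (∀ (k : ℕ) (i : Fin (Nk k)), Tendsto (fun δ : ℝ =>
        ((∫ x, (x.2 i) ^ 2 ∂(μ (Nk k) (T + δ / 2) (T - δ / 2))) - ∫ x, (x.2 i) ^ 2 ∂(μ (Nk k) T T)) / δ)
        (𝓝[≠] 0) (𝓝 (θk k i))) →
    (∀ k : ℕ, k ≤ xk k) → (∀ k : ℕ, xk k + k + 2 ≤ Nk k) →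
    (∀ k : ℕ, (k : ℝ) * ∑ i : Fin (Nk k), ∑ j : Fin (Nk k),
        (if j.val = i.val + 1 ∧ xk k ≤ i.val + k ∧ i.val ≤ xk k + k then |θk k j - θk k i| else 0) <
      |dk k| / ((Nk k : ℝ) - 1)) →
    ∃ Λ : (ChainConfig → ℝ) → ℝ,
      (∀ (a : ℤ) (n : ℕ) (c₁ c₂ : ℝ) (g₁ g₂ : (Fin (n + 1) → ℝ × ℝ) → ℝ), Continuous g₁ → Continuous g₂ →
        (∃ (C₀ : ℝ) (m : ℕ), ∀ y, |g₁ y| ≤ C₀ * (1 + ‖y‖) ^ m ∧ |g₂ y| ≤ C₀ * (1 + ‖y‖) ^ m) →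
        Λ ((fun y => c₁ * g₁ y + c₂ * g₂ y) ∘ boxRestrictAt a n) =
          c₁ * Λ (g₁ ∘ boxRestrictAt a n) + c₂ * Λ (g₂ ∘ boxRestrictAt a n)) ∧
      (∃ A : ℝ, ∀ (n : ℕ) (a : ℤ) (g : (Fin (n + 1) → ℝ × ℝ) → ℝ), Continuous g →
        (∃ (C₀ : ℝ) (m : ℕ), ∀ y, |g y| ≤ C₀ * (1 + ‖y‖) ^ m) →
        |Λ (g ∘ boxRestrictAt a n)| ≤
          A * Real.sqrt ((n : ℝ) + 1) * Real.sqrt (∫ σ, (g (boxRestrictAt a n σ)) ^ 2 ∂μinf)) ∧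
      (∀ (a : ℤ) (n : ℕ) (G : (Fin (n + 1) → ℝ × ℝ) → ℝ), ContDiff ℝ 1 G →
        (∃ (C₀ : ℝ) (m : ℕ), ∀ y, |G y| ≤ C₀ * (1 + ‖y‖) ^ m ∧ ‖fderiv ℝ G y‖ ≤ C₀ * (1 + ‖y‖) ^ m) →
        Λ (liouvilleZ (pinnedChain ω₂ lam β γ) (G ∘ boxRestrictAt a n)) = 0) ∧
      (∀ i : ℤ, Λ (fun σ => (pinnedChain ω₂ lam β γ).bondCurrentZ σ i) = 1) := by
  intro ω₂ lam β γ hω hl hβ _hγ _hU μ _hμ T hT hA hS2a μinf _hG _hS _hb1 hb1' hb2b hb2c hb3 hb4 Nk dk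
    θk xk hD hΘ hx₁ hx₂ hlt
  -- the ONE constant of the interior estimate at the CLT scale
  obtain ⟨A, hA⟩ := hA
  -- Gibbs facts of the pinned chain
  have hGprob : ∀ N : ℕ, IsProbabilityMeasure ((pinnedChain ω₂ lam β γ).gibbsMeasure N T) :=
    fun N => pinnedChain_isProbabilityMeasure_gibbsMeasure hω hl.le hβ.le γ N hT
  have hGcur : ∀ (N : ℕ) (i : Fin N), ∫ z, (pinnedChain ω₂ lam β γ).bondCurrent N i z
      ∂((pinnedChain ω₂ lam β γ).gibbsMeasure N T) = 0 :=
    fun N i => pinnedChain_integral_bondCurrent_gibbsMeasure ω₂ lam β γ N T i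
  set P := pinnedChain ω₂ lam β γ with hP
  -- the finite-`N` package, unpacked
  have ha1 : ∀ N : ℕ, 3 ≤ N → μ N T T = P.gibbsMeasure N T := fun N h => (hS2a N h).1
  have ha2 := fun N (h : 3 ≤ N) => (hS2a N h).2.1
  have ha3 := fun N (h : 3 ≤ N) => (hS2a N h).2.2.1
  have ha4 := fun N (h : 3 ≤ N) => (hS2a N h).2.2.2
  -- the normalisation `g_k = d_k/(N_k - 1)` is non-zero
  have hdk : ∀ k : ℕ, dk k ≠ 0 := fun k =>
    ne_zero_of_mul_windowVariation_lt (θk k) (xk k) k (dk k) _ (hlt k)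
  -- the translation-uniform eventual bound of the level functionals (WEAK REGULARITY at level `k`)
  -- IN THE `√n` CLASS: the interior estimate (A♯) at radius `n` is the estimate (A) with constant
  -- `A √(n+1)`, so the eventual level bound holds with `2|A √(n+1)|`; the per-observable constant
  -- `B(g)` of (b3') is absorbed into the `ε`
  have key : ∀ (n : ℕ) (a : ℤ) (g : (Fin (n + 1) → ℝ × ℝ) → ℝ), Continuous g →
      (∃ (C₀ : ℝ) (m : ℕ), ∀ y, |g y| ≤ C₀ * (1 + ‖y‖) ^ m) → ∀ ε : ℝ, 0 < ε →
      ∀ᶠ k in atTop,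
        |(limUnder (𝓝[≠] (0 : ℝ)) (fun δ : ℝ =>
              ((∫ z, g (boxRestrictAt a n (embed (Nk k) (xk k) z))
                  ∂(μ (Nk k) (T + δ / 2) (T - δ / 2))) -
                ∫ z, g (boxRestrictAt a n (embed (Nk k) (xk k) z)) ∂(μ (Nk k) T T)) / δ) -
            (∑ i : Fin (Nk k), if i.val = xk k then θk k i else 0) *
              (((∫ z, g (boxRestrictAt a n (embed (Nk k) (xk k) z)) * P.hamiltonian (Nk k) z
                  ∂(P.gibbsMeasure (Nk k) T)) -
                (∫ z, g (boxRestrictAt a n (embed (Nk k) (xk k) z)) ∂(P.gibbsMeasure (Nk k) T)) *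
                  (∫ z, P.hamiltonian (Nk k) z ∂(P.gibbsMeasure (Nk k) T))) / T ^ 2)) /
            (dk k / ((Nk k : ℝ) - 1))| ≤
          2 * |A * Real.sqrt ((n : ℝ) + 1)| *
              Real.sqrt ((∫ σ, (g (boxRestrictAt a n σ)) ^ 2 ∂μinf) + ε) + ε := by
    intro n a g hg hgb ε hε
    obtain ⟨b, hA'⟩ := hA n
    obtain ⟨B, hB⟩ := hb3 n g hg hgb
    exact eventually_level_bound' P μ hT n b (A * Real.sqrt ((n : ℝ) + 1)) hA' ha1 ha2 hb4 Nk dk θk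
      xk hD hΘ hx₁ hx₂ hlt a g hg hgb B hB ε hε
  -- the functional: generalised limit over `k` of the normalised level functionals
  refine ⟨fun F => limUnder (hyperfilter ℕ : Filter ℕ) (fun k =>
      (limUnder (𝓝[≠] (0 : ℝ)) (fun δ : ℝ =>
          ((∫ z, F (embed (Nk k) (xk k) z) ∂(μ (Nk k) (T + δ / 2) (T - δ / 2))) -
            ∫ z, F (embed (Nk k) (xk k) z) ∂(μ (Nk k) T T)) / δ) -
        (∑ i : Fin (Nk k), if i.val = xk k then θk k i else 0) *
          (((∫ z, F (embed (Nk k) (xk k) z) * P.hamiltonian (Nk k) z ∂(P.gibbsMeasure (Nk k) T)) -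
            (∫ z, F (embed (Nk k) (xk k) z) ∂(P.gibbsMeasure (Nk k) T)) *
              (∫ z, P.hamiltonian (Nk k) z ∂(P.gibbsMeasure (Nk k) T))) / T ^ 2)) /
        (dk k / ((Nk k : ℝ) - 1))), ?_, ?_, ?_, ?_⟩
  · -- (1) linearity: eventual linearity at level `k`, both sequences eventually bounded by `key`
    intro a n c₁ c₂ g₁ g₂ hg₁ hg₂ hgb
    obtain ⟨C₀, m, hC₀⟩ := hgb
    simp only [Function.comp_apply]
    exact hyperfilter_limUnder_linear c₁ c₂ (key n a g₁ hg₁ ⟨C₀, m, fun y => (hC₀ y).1⟩ 1 one_pos)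
      (key n a g₂ hg₂ ⟨C₀, m, fun y => (hC₀ y).2⟩ 1 one_pos)
      (eventually_level_linear P μ T hGprob ha1 ha2 hb1' Nk dk θk xk hx₂ a n c₁ c₂ g₁ g₂ hg₁ hg₂
        ⟨C₀, m, fun y => (hC₀ y).1⟩ ⟨C₀, m, fun y => (hC₀ y).2⟩)
  · -- (2♯) `√n`-regularity with ONE constant `2|A|`: the `ε`'s are removed in the limit
    refine ⟨2 * |A|, fun n a g hg hgb => ?_⟩
    simp only [Function.comp_apply]
    exact abs_hyperfilter_limUnder_le_mul_sqrt_succ n (key n a g hg hgb)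
  · -- (3) invariance: the level values vanish eventually
    intro a n G hG hGb
    refine hyperfilter_limUnder_eq_of_eventually_eq ?_
    filter_upwards [eventually_ge_atTop (a.natAbs + n + 3)] with k hk
    have hxk := hx₁ k
    have hNk := hx₂ k
    have hN3 : 3 ≤ Nk k := by omega
    exact level_liouville_eq_zero P (μ (Nk k)) hT _ _ a n (xk k) G
      (fun T_L T_R hL hR =>
        (ha3 (Nk k) hN3 T_L T_R hL hR a n (xk k) (by omega) (by omega) G hG hGb).2)
      (hb2c (Nk k) a n (xk k) (by omega) (by omega) G hG hGb)
  · -- (4) unit current: the level values are `1` eventually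
    intro i
    refine hyperfilter_limUnder_eq_of_eventually_eq ?_
    filter_upwards [eventually_ge_atTop (i.natAbs + 3)] with k hk
    have hxk := hx₁ k
    have hNk := hx₂ k
    have hN3 : 3 ≤ Nk k := by omega
    refine level_current_eq_one P (μ (Nk k)) hT _ (dk k) (xk k) i ⟨(i + xk k).toNat, by omega⟩
      (by simp only; omega) (by simp only; omega) (hD k) (ha4 (Nk k) hN3) ?_ (hb2b (Nk k) _) (hdk k)
    rw [ha1 (Nk k) hN3]
    exact hGcur (Nk k) _

end Summit.AtomisticToContinuum.FouriersLaw.Theorems.LocalOhmBirth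

end
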